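import Mathlib
import Summits.ResolutionOfSingularities.ResolutionOfSingularities.Theorems.WildQuotientsWildQuotientResolutionJordanFiveMu2CoverDefs
import Summits.ResolutionOfSingularities.ResolutionOfSingularities.Theorems.WildQuotientsWildQuotientResolutionJordanFiveTwistedChartDefs
import Summits.ResolutionOfSingularities.ResolutionOfSingularities.Theorems.WildQuotientsWildQuotientResolutionJordanFiveFrameDefs

/-!
# RUNG V5 (`J₅`), brick B7/HP₂ — the cover substitution `x ↦ s^w Y` (definitions of record)

Sub-problem `ResolutionOfSingularities`, crux `WildQuotients.WildQuotientResolution`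
(stmt-ResolutionOfSingularities-15640), line L1 W4.5c, scaffold
`JordanFive.jordanFive_hasResolution_of_bricks` (p527978), brick `HP₂` (res-L1-w45c-plan-1 RULING
10:50Z; W2-DESIGN §6 of res-L1-w45c-idea-2). [OURS · L1 W4.5c] — NOT a statement of any manuscript.

The twisted-root cover `U₂ → W₂` of the `μ₂`-vertex chart is, on coordinate rings, the substitution
`JordanFive.coverSubst : k[x₁,…,xₙ] → k[s, Y₀,…,Y₄, pass]` (`s = X none`, `Y_i = X (some ·)`):

  `x_a ↦ s⁴Y₀, x_b ↦ s³Y₁, x_c ↦ s²Y₂, x_d ↦ sY₃, x_i ↦ Y_i (i ∉ {a,b,c,d}`, in particular `x_e ↦ Y₄`)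

(weights `(4,3,2,1,0)`), followed by `k[s,Y,pass] → U₂ = (k[s,Y,pass] ⧸ (Φ))[1/î]`.  Dictionary:
`coverSubst i₂ = s⁴·î`, `coverSubst (2j₃) = s⁶·ĵ` (`î, ĵ = coverIHat, coverJHat` of …`Mu2CoverDefs`),
`coverSubst g_j = s^{4α+3β+2γ+δ}·Y₀^α Y₁^β Y₂^γ Y₃^δ` for the 40 generators `g_j = gens12 j` of `I₁₂`.
-/

-- single-problem summit: the doubled namespace component `ResolutionOfSingularities` is forced
set_option linter.dupNamespace false

noncomputable section

open MvPolynomial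

namespace Summit.ResolutionOfSingularities.ResolutionOfSingularities.Theorems.WildQuotientResolution.JordanFive

variable (k : Type) [Field k] (n : ℕ) (a b c d e : Fin n)

/-- The cover substitution on variables: `x_a ↦ s⁴Y₀, x_b ↦ s³Y₁, x_c ↦ s²Y₂, x_d ↦ sY₃, x_i ↦ Y_i`.
[OURS · L1 W4.5c] -/
def coverSubstFun : Fin n → MvPolynomial (Option (Fin n)) k := fun i =>
  if i = a then X none ^ 4 * X (some a) else if i = b then X none ^ 3 * X (some b)
  else if i = c then X none ^ 2 * X (some c) else if i = d then X none * X (some d) else X (some i)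

/-- **The cover substitution `coverSubst : k[x] → k[s, Y, pass]`** of the `μ₂` twisted-root cover
`U₂ → W₂` (W2-DESIGN §6). [OURS · L1 W4.5c] -/
def coverSubst : MvPolynomial (Fin n) k →ₐ[k] MvPolynomial (Option (Fin n)) k :=
  aeval (coverSubstFun k n a b c d)

/-- `coverSubst x_a = s⁴Y₀`. [OURS · L1 W4.5c] -/
theorem coverSubst_X_a : coverSubst k n a b c d (X a) = X none ^ 4 * X (some a) := by
  rw [coverSubst, aeval_X, coverSubstFun, if_pos rfl]

/-- `coverSubst x_b = s³Y₁`. [OURS · L1 W4.5c] -/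
theorem coverSubst_X_b (hab : a ≠ b) : coverSubst k n a b c d (X b) = X none ^ 3 * X (some b) := by
  rw [coverSubst, aeval_X, coverSubstFun, if_neg (Ne.symm hab), if_pos rfl]

/-- `coverSubst x_c = s²Y₂`. [OURS · L1 W4.5c] -/
theorem coverSubst_X_c (hac : a ≠ c) (hbc : b ≠ c) :
    coverSubst k n a b c d (X c) = X none ^ 2 * X (some c) := by
  rw [coverSubst, aeval_X, coverSubstFun, if_neg (Ne.symm hac), if_neg (Ne.symm hbc), if_pos rfl]

/-- `coverSubst x_d = sY₃`. [OURS · L1 W4.5c] -/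
theorem coverSubst_X_d (had : a ≠ d) (hbd : b ≠ d) (hcd : c ≠ d) :
    coverSubst k n a b c d (X d) = X none * X (some d) := by
  rw [coverSubst, aeval_X, coverSubstFun, if_neg (Ne.symm had), if_neg (Ne.symm hbd),
    if_neg (Ne.symm hcd), if_pos rfl]

/-- `coverSubst x_i = Y_i` for `i ∉ {a, b, c, d}` (in particular `x_e ↦ Y₄`). [OURS · L1 W4.5c] -/
theorem coverSubst_X_of_ne (i : Fin n) (hia : i ≠ a) (hib : i ≠ b) (hic : i ≠ c) (hid : i ≠ d) :
    coverSubst k n a b c d (X i) = X (some i) := by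
  rw [coverSubst, aeval_X, coverSubstFun, if_neg hia, if_neg hib, if_neg hic, if_neg hid]

/-- `coverSubst (C r) = C r`. [OURS · L1 W4.5c] -/
theorem coverSubst_C (r : k) : coverSubst k n a b c d (C r) = C r := by
  rw [coverSubst, aeval_C]; rfl

/-- **`coverSubst i₂ = s⁴·î`.** [OURS · L1 W4.5c; W2-DESIGN §6] -/
theorem coverSubst_iTwo (hab : a ≠ b) (hac : a ≠ c) (had : a ≠ d) (hae : a ≠ e) (hbc : b ≠ c)
    (hbd : b ≠ d) (hbe : b ≠ e) (hcd : c ≠ d) (hce : c ≠ e) (hde : d ≠ e) :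
    coverSubst k n a b c d (iTwo k n a b c d e) =
      X none ^ 4 * coverIHat (X none) (X (some a)) (X (some b)) (X (some c)) (X (some d))
        (X (some e)) := by
  simp only [iTwo, map_add, map_sub, map_mul, map_pow, map_ofNat, coverSubst_X_a,
    coverSubst_X_b k n a b c d hab, coverSubst_X_c k n a b c d hac hbc,
    coverSubst_X_d k n a b c d had hbd hcd,
    coverSubst_X_of_ne k n a b c d e hae.symm hbe.symm hce.symm hde.symm, coverIHat]
  ring

/-- **`coverSubst (2j₃) = s⁶·ĵ`.** [OURS · L1 W4.5c; W2-DESIGN §6] -/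
theorem coverSubst_jThreeTwo (hab : a ≠ b) (hac : a ≠ c) (had : a ≠ d) (hae : a ≠ e) (hbc : b ≠ c)
    (hbd : b ≠ d) (hbe : b ≠ e) (hcd : c ≠ d) (hce : c ≠ e) (hde : d ≠ e) :
    coverSubst k n a b c d (jThreeTwo k n a b c d e) =
      X none ^ 6 * coverJHat (X none) (X (some a)) (X (some b)) (X (some c)) (X (some d))
        (X (some e)) := by
  simp only [jThreeTwo, map_add, map_sub, map_mul, map_pow, map_ofNat, coverSubst_X_a,
    coverSubst_X_b k n a b c d hab, coverSubst_X_c k n a b c d hac hbc,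
    coverSubst_X_d k n a b c d had hbd hcd,
    coverSubst_X_of_ne k n a b c d e hae.symm hbe.symm hce.symm hde.symm, coverJHat]
  ring

/-- **`coverSubst g_j = s^{4α+3β+2γ+δ} · Y₀^α Y₁^β Y₂^γ Y₃^δ`** for the 40 generators of `I₁₂`
(`(α,β,γ,δ) = exps12 j`). [OURS · L1 W4.5c] -/
theorem coverSubst_gens12 (hab : a ≠ b) (hac : a ≠ c) (had : a ≠ d) (hbc : b ≠ c) (hbd : b ≠ d)
    (hcd : c ≠ d) (j : Fin 40) :
    coverSubst k n a b c d (gens12 k n a b c d j) =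
      X none ^ (4 * (exps12 j).1 + 3 * (exps12 j).2.1 + 2 * (exps12 j).2.2.1 + (exps12 j).2.2.2) *
        (X (some a) ^ (exps12 j).1 * X (some b) ^ (exps12 j).2.1 * X (some c) ^ (exps12 j).2.2.1 *
          X (some d) ^ (exps12 j).2.2.2) := by
  rw [gens12_eq_monomial, map_mul, map_mul, map_mul, map_pow, map_pow, map_pow, map_pow,
    coverSubst_X_a, coverSubst_X_b k n a b c d hab, coverSubst_X_c k n a b c d hac hbc,
    coverSubst_X_d k n a b c d had hbd hcd]
  ring

end Summit.ResolutionOfSingularities.ResolutionOfSingularities.Theorems.WildQuotientResolution.JordanFive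

end
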